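import Literature.AnabelianGeometry.EtaleTheta.Discharge.Sec5RhoKernelOfConnectedTemperoid
import Literature.AnabelianGeometry.EtaleTheta.Discharge.Sec5OfConnectedTemperoidYddFacts
import Literature.AnabelianGeometry.EtaleTheta.TowerOfSetting
import Literature.AnabelianGeometry.SemiGraphs.TemperedArithmeticGroupOfOpenSubgroup

/-!
# [EtTh] §5 data OF THE §1 SETTING: `Π^tp_X̲̲`, `B^temp(Π^tp_X̲̲)⁰`, `Π^tp_Ÿ̲̲`, `μ_N`, the theta cocycles — all read on the
# `ThetaSetting` (§5 p.322, pp.330–331 / PDF p.96, pp.104–105)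

Mochizuki, *The étale theta function …*, Publ. RIMS **45** (2009), §5 p.322 (PDF p.96): "we return to the situation of Example 3.9 …
'`A`' is one of the smooth log orbicurves `X̲^log; C̲^log; X̲̲^log; C̲̲^log; …` [each of which is geometrically connected over the field
`K = K̈`] of Definition 2.5 … the *double underline case* … the divisor monoid `Φ` on `D = D_α` determines a tempered Frobenioid `C` of
monoid type `ℤ` over the base category `D`"; pp.330–331 (PDF pp.104–105): "`A` arises from `X̲̲^log`", the data
`(A_N, B_N, s^⊓_N, s^⊔_N)`, "the natural surjective outer homomorphism `Π^tp_X ↠ Aut_D(B_N^bs)`".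
[cite: MochizukiEtTh2009, §5 p.322 (PDF p.96); §5 p.330–331 (PDF pp.104–105)]

abc-iut cell, layer L2, seat abc-iut-L2-t4 (§5 owner, gen 4), ROW W3-L2-01 «§5 GENUINE DATA»: continuation of gen 3's
`Discharge/Sec5OfConnectedTemperoid.lean` (p427614; the §5 data over the genuine connected base `B^temp(Π)⁰` for a FREE group-level
datum `X : TemperedArithmeticGroup K`, a FREE §2 datum `T : ThetaEnvData N` and a FREE identification `ιX : T.PiX ≃ₜ* X.Pi`).
THIS FILE PINS THE THREE Π-SIDE INPUTS TO THE §1 SETTING (additive; nothing landed is touched):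
* `X :=` **`ThetaSetting.EtaleThetaData.DoubleUnderline.temperedArithmeticGroup C e`** — [SemiAnbd] Ex. 3.10 for the curve `X̲̲`
  of Def. 2.5 (i): the OPEN subgroup `Π^tp_X̲̲ = C.Huu ⊆ Π^tp_X` of abc-iut-L2-t8's `DoubleUnderline` datum, with augmentation onto
  `G_K` ("geometrically connected over `K`", p.322; abc-iut-L2-t8's `map_aug_Huu`), via the generic
  `TemperedCurve.temperedArithmeticGroupOfOpenSubgroup` (`SemiGraphs/TemperedArithmeticGroupOfOpenSubgroup.lean`) and
  abc-iut-L3's bridge parameters `e : GroupLevelData`; so the base category is **`B^temp(Π^tp_X̲̲)⁰ = ConnectedPart (BTemp C.Huu)`**;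
* `T :=` abc-iut-L2-t8's **`C.thetaEnvData μ hC hS`** (`ThetaEnvOfSetting.lean`: `Π^tp_X̲̲ := C.Huu`, `Π^tp_Ÿ̲̲`, `μ_N`, `χ`, the mod `N`
  theta cocycles — every axiom proved there);
* `ιX :=` **the identity** `ContinuousMulEquiv.refl C.Huu`.
Results: `BiKummerSetting.mkOfThetaSettingYdd` (the §4 setting with `A_⊙^bs := Ÿ̲̲`, **`H_⊙ = Π^tp_Ÿ̲̲` on the nose**,
`Hodot_mkOfThetaSettingYdd`); **`ThetaFrobenioid.ofThetaSettingData`** (= `ofConnectedTemperoidData` at these inputs, `rfl`) with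
`𝔉.PiX = Π^tp_X̲̲`, `𝔉.PiYdd = Π^tp_Ÿ̲̲`, `ρ_N =` the Setting's Galois surjection at `A_N^bs` conjugated by `(s^⊓_N)^bs`,
**`Ker ρ_N = N_{A_N} ≤ Π^tp_X̲̲` literally** (`rho_ofThetaSettingData_eq_one_iff`), the augmentation dictionary `T.aug` vs `X.aug`
(`temperedArithmeticGroup_aug_eq`), `Facts ⟸ {hH, hconst, hgc}` / `⟸ {hconst, hgc}` for `A_⊙^bs := Ÿ̲̲`, and the divisor inputs from
the `Π^tp_X̲̲`-stability `hθ`, `hθ'` of `Div(Θ̈)_±`; and the TOWER over all levels `M ∈ E` (`ThetaFrobenioidTower.ofThetaSettingFamily` over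
abc-iut-L2-t8's `C.thetaEnvTower τ hC hS`, `TowerOfSetting.lean`; `atLevel M = ofThetaSettingData (τ.mod M) …` by `rfl`).
RESIDUAL INPUTS of the §5 data after this file (each printed; none a Prop-valued definition): the tempered Frobenioid
`tf : TemperedFrobenioid T₀ (ConnectedPart (BTemp C.Huu)) VD` of Example 3.9 over `B^temp(Π^tp_X̲̲)⁰` (abc-iut-L2-t3's Def. 3.6 (ii)
DATA — abstract: the divisor monoid / rational functions of the actual curve are not in the tree), `h` ([FrdI] Thm. 5.2
hypotheses), `Q`, the roots `Rl`, `R`, the constants `K', constEmb`, `hθ/hθ'` (Prop. 1.4 (i); GAP G-L2t4-2), `hconst` (Def. 3.6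
(iii); G-L2t4-3, discharged for the terminal-object shape by abc-iut-w4-d008's `Sec5ConstEmbOfTerminal`), `hgc` (Lemma 5.8; G-L2t4-4),
`NH` [tower: the Rmk. 4.3.2 transitions `α, β` with their squares / isometry / degree / base-Frobenius clauses]; Setting side `e`,
`hC : Compat`, `hS : Sec2Hyps`, `μ : CyclotomeMod` [tower: `τ : CyclotomeTower`].
HONEST FRAMING: constructions and kernel-checked bookkeeping over data structures quoting print; the parameter `tf` is NOT shown
inhabited for the curve; [EtTh] is refereed; nothing here takes a side on [IUTchIII] Cor. 3.12; typed ≠ proved.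
-/

noncomputable section

namespace Literature.AnabelianGeometry.EtaleTheta

open CategoryTheory Opposite Literature.AlgebraicGeometry.Frobenioids Literature.AnabelianGeometry.SemiGraphs
  Literature.AnabelianGeometry.SemiGraphs.GaloisObjects Literature.AlgebraicGeometry.Frobenioids.QuasiTemperoid.BTempConnected

universe v₀

/-! ## `Π^tp_X̲̲` of the Setting as an [SemiAnbd] Ex. 3.10 datum over `K` -/

namespace ThetaSetting.EtaleThetaData.DoubleUnderline

variable {p : ℕ} [Fact p.Prime] {D : ThetaSetting p} {E : D.EtaleThetaData} {l : ℕ} (C : E.DoubleUnderline l)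

/-- `l ≥ 1` as a positive natural (`l` is odd, Def. 2.5 / [IUTchI] Rmk. 3.1.6). [cite: MochizukiEtTh2009, Def 2.5 (i) p.39] -/
def lPNat : ℕ+ := ⟨l, C.l_odd.pos⟩

/-- `(lPNat : ℕ) = l`. [cite: MochizukiEtTh2009, Def 2.5 (i) p.39] -/
@[simp] theorem coe_lPNat : (C.lPNat : ℕ) = l := rfl

/-- `l` is odd, read on `lPNat`. [cite: MochizukiEtTh2009, Def 2.5 (i) p.39] -/
theorem odd_lPNat : Odd (C.lPNat : ℕ) := C.l_odd

variable (e : D.toTemperedCurve.GroupLevelData)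

/-- **`Π^tp_X̲̲` with its augmentation onto `G_K`** as an [SemiAnbd] Ex. 3.10 datum over `K` (the curve `X̲̲` of Def. 2.5 (i) is a
finite étale covering of `X` defined over `K`): the open subgroup `C.Huu ⊆ Π^tp_X` of the bridge datum of the Setting.  This is the
"`Π^tp_X`" of §5 in the double underline case (p.322), whose connected temperoid `B^temp(Π^tp_X̲̲)⁰` is the base category `D`.
[cite: MochizukiEtTh2009, §5 p.322 (PDF p.96)] -/
def temperedArithmeticGroup : TemperedArithmeticGroup D.K :=
  D.toTemperedCurve.temperedArithmeticGroupOfOpenSubgroup e C.Huu C.isOpen_Huu C.map_aug_Huu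

/-- Its group is `Π^tp_X̲̲ = C.Huu` (definitionally). [cite: MochizukiEtTh2009, §5 p.322 (PDF p.96)] -/
@[simp] theorem temperedArithmeticGroup_Pi : (C.temperedArithmeticGroup e).Pi = C.Huu := rfl

/-- Its augmentation is the Setting's, read in `Gal(K̄/K)` through the bridge identification `e.galEquiv`.
[cite: MochizukiEtTh2009, §5 p.322 (PDF p.96)] -/
theorem temperedArithmeticGroup_aug_apply (g : C.Huu) :
    (C.temperedArithmeticGroup e).aug g = D.toTemperedCurve.augK e.galEquiv g := rfl

/-- **Augmentation dictionary `T` ↔ `X`**: the augmentation of abc-iut-L2-t8's §2 datum `C.thetaEnvData μ hC hS` (values in `G_K ≤ G_{ℚ_p}`)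
and that of the Ex. 3.10 datum agree through `e.galEquiv : G_K ≃ Gal(K̄/K)`.  [cite: MochizukiEtTh2009, Def 2.13 p.47; §5 p.322 (PDF p.96)] -/
theorem temperedArithmeticGroup_aug_eq {N : ℕ+} (μ : D.CyclotomeMod l N) (hC : D.Compat) (hS : D.Sec2Hyps) (g : C.Huu) :
    (C.temperedArithmeticGroup e).aug g = e.galEquiv ((C.thetaEnvData μ hC hS).aug g) := by
  change e.galEquiv (D.toTemperedCurve.augGK g) = e.galEquiv _
  congr 1

end ThetaSetting.EtaleThetaData.DoubleUnderline

/-! ## The §4 setting over `B^temp(Π^tp_X̲̲)⁰` with `A_⊙^bs := Ÿ̲̲` -/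

namespace BiKummerSetting

variable {p : ℕ} [Fact p.Prime] {D : ThetaSetting p} {E : D.EtaleThetaData} {l : ℕ} (C : E.DoubleUnderline l)
  (e : D.toTemperedCurve.GroupLevelData) {N : ℕ+} (μ : D.CyclotomeMod l N) (hC : D.Compat) (hS : D.Sec2Hyps)
  {D₀ : Type} [Category.{v₀} D₀] {V : FrdIMonoidStub.{0}} {T₀ : RealifiedDivisorMonoids (D₀ := D₀) V}
  {VD : FrdICatStub.{1, 0, 0} (ConnectedPart (BTemp (C.temperedArithmeticGroup e).Pi))}
  (tf : TemperedFrobenioid T₀ (ConnectedPart (BTemp (C.temperedArithmeticGroup e).Pi)) VD) (hZ : tf.monoidType = MonoidType.Z)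
  (hP : ∀ A : (ConnectedPart (BTemp (C.temperedArithmeticGroup e).Pi))ᵒᵖ, IsPerfect (tf.Φ.carrier A))
  (NH : Subgroup (Field.absoluteGaloisGroup D.K) → tf.category → ℕ+ → Prop)

/-- **The §4/§5 setting OF THE SETTING**: gen 3's `mkOfConnectedTemperoidYdd` over `B^temp(Π^tp_X̲̲)⁰` with `T := C.thetaEnvData μ hC hS` and
`ιX := id` — `A_⊙ := (Π^tp_X̲̲/Π^tp_Ÿ̲̲, 0)`, i.e. `A_⊙^bs := Ÿ̲̲`, "the [Frobenius-trivial] object defined by the trivial line bundle over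
`Ÿ̲̲^log`" (p.322).  An `abbrev`, so every theorem about `mkOfConnectedTemperoid(Ydd)` applies by unification.
[cite: MochizukiEtTh2009, §5 p.322 (PDF p.96)] -/
abbrev mkOfThetaSettingYdd : BiKummerSetting (C.temperedArithmeticGroup e) T₀ (ConnectedPart (BTemp (C.temperedArithmeticGroup e).Pi)) VD :=
  mkOfConnectedTemperoidYdd (C.temperedArithmeticGroup e) tf hZ hP NH (C.thetaEnvData μ hC hS) (ContinuousMulEquiv.refl _)

/-- **`H_⊙ = Π^tp_Ÿ̲̲` on the nose** for the setting of the Setting (`Π^tp_Ÿ̲̲ = Π^tp_Ÿ ∩ Π^tp_X̲̲` read in `Π^tp_X̲̲`).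
[cite: MochizukiEtTh2009, Def 4.1 p.312 (PDF p.86); §5 p.322 (PDF p.96)] -/
theorem mem_Hodot_mkOfThetaSettingYdd_iff (g : C.Huu) :
    g ∈ (mkOfThetaSettingYdd C e μ hC hS tf hZ hP NH).Hodot ↔ (g : D.PiTemp) ∈ D.GtpYdd :=
  mem_Hodot_mkOfConnectedTemperoidYdd_iff (C.temperedArithmeticGroup e) tf hZ hP NH (C.thetaEnvData μ hC hS)
    (ContinuousMulEquiv.refl _) g

/-- **`H_⊙ = Π^tp_Ÿ̲̲`** (subgroup form). [cite: MochizukiEtTh2009, Def 4.1 p.312 (PDF p.86); §5 p.322 (PDF p.96)] -/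
theorem Hodot_mkOfThetaSettingYdd : (mkOfThetaSettingYdd C e μ hC hS tf hZ hP NH).Hodot = D.GtpYdd.subgroupOf C.Huu :=
  Subgroup.ext (mem_Hodot_mkOfThetaSettingYdd_iff C e μ hC hS tf hZ hP NH)

/-- **The §5 binder `hH` (`Π^tp_Ÿ̲̲ ⊆ H_⊙`) for the Setting** — in the shape the `ofConnectedTemperoidData` theorems consume (`ιX := id`).
[cite: MochizukiEtTh2009, §5 p.330 (PDF p.104)] -/
theorem hH_mkOfThetaSettingYdd :
    ∀ y : (C.thetaEnvData μ hC hS).PiX, y ∈ (C.thetaEnvData μ hC hS).PiYdd →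
      (ContinuousMulEquiv.refl _) y ∈ (mkOfThetaSettingYdd C e μ hC hS tf hZ hP NH).Hodot :=
  hH_mkOfConnectedTemperoidYdd (C.temperedArithmeticGroup e) tf hZ hP NH (C.thetaEnvData μ hC hS) (ContinuousMulEquiv.refl _)

end BiKummerSetting

/-! ## The §5 data of the Setting -/

namespace ThetaFrobenioid

variable {p : ℕ} [Fact p.Prime] {D : ThetaSetting p} {E : D.EtaleThetaData} {l : ℕ} {C : E.DoubleUnderline l}
  {e : D.toTemperedCurve.GroupLevelData} {N : ℕ+} (μ : D.CyclotomeMod l N) (hC : D.Compat) (hS : D.Sec2Hyps)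
  {D₀ : Type} [Category.{v₀} D₀] {V : FrdIMonoidStub.{0}} {T₀ : RealifiedDivisorMonoids (D₀ := D₀) V}
  {VD : FrdICatStub.{1, 0, 0} (ConnectedPart (BTemp (C.temperedArithmeticGroup e).Pi))}
  {tf : TemperedFrobenioid T₀ (ConnectedPart (BTemp (C.temperedArithmeticGroup e).Pi)) VD} {hZ : tf.monoidType = MonoidType.Z}
  {hP : ∀ A : (ConnectedPart (BTemp (C.temperedArithmeticGroup e).Pi))ᵒᵖ, IsPerfect (tf.Φ.carrier A)}
  {NH : Subgroup (Field.absoluteGaloisGroup D.K) → tf.category → ℕ+ → Prop} {A₀ : tf.category}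
  {hA₀ : PreFrobenioid.IsFrobeniusTrivial tf.toElem A₀} {hA₀' : SemiGraphs.IsGaloisObj A₀.base.obj}
  {pullFrac : ∀ {A A' : (BiKummerSetting.mkOfConnectedTemperoid (C.temperedArithmeticGroup e) tf hZ hP NH A₀ hA₀ hA₀').C} (_ : A' ⟶ A),
    (BiKummerSetting.mkOfConnectedTemperoid (C.temperedArithmeticGroup e) tf hZ hP NH A₀ hA₀ hA₀').biratUnits A →
      (BiKummerSetting.mkOfConnectedTemperoid (C.temperedArithmeticGroup e) tf hZ hP NH A₀ hA₀ hA₀').biratUnits A'}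
  {θ : (BiKummerSetting.mkOfConnectedTemperoid (C.temperedArithmeticGroup e) tf hZ hP NH A₀ hA₀ hA₀').biratUnits
    (BiKummerSetting.mkOfConnectedTemperoid (C.temperedArithmeticGroup e) tf hZ hP NH A₀ hA₀ hA₀').Aodot}
  {Bl : (BiKummerSetting.mkOfConnectedTemperoid (C.temperedArithmeticGroup e) tf hZ hP NH A₀ hA₀ hA₀').C}
  {Pl : (BiKummerSetting.mkOfConnectedTemperoid (C.temperedArithmeticGroup e) tf hZ hP NH A₀ hA₀ hA₀').FractionPair θ Bl}
  {Rl : (BiKummerSetting.mkOfConnectedTemperoid (C.temperedArithmeticGroup e) tf hZ hP NH A₀ hA₀ hA₀').NthRoot θ Pl C.lPNat pullFrac}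
  (h : ModelFrobenioid.Hypotheses tf.divisorMonoid tf.ratFnFunctor)
  (Q : FrobenioidTheta.ThetaSubquotientStub.{0} (ConnectedPart (BTemp (C.temperedArithmeticGroup e).Pi)))
  (R : (BiKummerSetting.mkOfConnectedTemperoid (C.temperedArithmeticGroup e) tf hZ hP NH A₀ hA₀ hA₀').NthRoot Rl.root Rl.pair N pullFrac)
  (K' : Type) [Field K'] (constEmb : K'ˣ →* tf.biratUnitsModel R.BN) (constEmb_injective : Function.Injective constEmb)

section General

variable
  (hinvc : ∀ g : Aut R.AN.base,
    pull tf.divisorMonoid g.hom (ModelFrobenioid.div R.pair.num) = ModelFrobenioid.div R.pair.num)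
  (hinvp : ∀ y : (C.thetaEnvData μ hC hS).PiX, y ∈ (C.thetaEnvData μ hC hS).PiYdd →
    pull tf.divisorMonoid ((BiKummerSetting.mkOfConnectedTemperoid (C.temperedArithmeticGroup e) tf hZ hP NH A₀ hA₀ hA₀').galoisSurj
      R.AN.base R.αData.isGalois ((ContinuousMulEquiv.refl _) y)).hom (ModelFrobenioid.div R.pair.den) = ModelFrobenioid.div R.pair.den)

/-- **The [EtTh] §5 data OF THE SETTING** ("`A` arises from `X̲̲^log`", double underline case, p.322; pp.330–331 (PDF pp.104–105)):
gen 3's `ofConnectedTemperoidData` over `B^temp(Π^tp_X̲̲)⁰` with the §2 datum `T := C.thetaEnvData μ hC hS` of abc-iut-L2-t8 and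
`ιX := id`; `l :=` the `l` of the `DoubleUnderline` datum (odd).  So `𝔉.PiX = Π^tp_X̲̲ = C.Huu`, `𝔉.PiYdd = Π^tp_Ÿ̲̲`, `μ_N`, `χ`, the theta
cocycles are the Setting's, and `ρ_N : Π^tp_X̲̲ ↠ Aut_D(B_N^bs)` is the Setting's Galois surjection at `A_N^bs` conjugated by `(s^⊓_N)^bs`.
[cite: MochizukiEtTh2009, §5 p.322 (PDF p.96); §5 p.330–331 (PDF pp.104–105)] -/
def ofThetaSettingData :
    ThetaFrobenioid.{0} (BiKummerSetting.mkOfConnectedTemperoid (C.temperedArithmeticGroup e) tf hZ hP NH A₀ hA₀ hA₀').C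
      (ConnectedPart (BTemp (C.temperedArithmeticGroup e).Pi)) :=
  ofConnectedTemperoidData (T := C.thetaEnvData μ hC hS) h Q C.odd_lPNat R (ContinuousMulEquiv.refl _) K' constEmb
    constEmb_injective hinvc hinvp

/-- `ofThetaSettingData` IS `ofConnectedTemperoidData` at `(X, T, ιX) := (Π^tp_X̲̲, C.thetaEnvData μ hC hS, id)` (definitionally) — every
theorem of `Sec5OfConnectedTemperoid*` / `FrobenioidThetaOfBiKummerData` applies verbatim.  [cite: MochizukiEtTh2009, §5 p.330–331 (PDF pp.104–105)] -/
theorem ofThetaSettingData_eq :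
    ofThetaSettingData μ hC hS h Q R K' constEmb constEmb_injective hinvc hinvp =
      ofConnectedTemperoidData (T := C.thetaEnvData μ hC hS) h Q C.odd_lPNat R (ContinuousMulEquiv.refl _) K' constEmb
        constEmb_injective hinvc hinvp := rfl

/-- **`𝔉.PiX = Π^tp_X̲̲`** — the tempered group of the §5 data is the Setting's `C.Huu`, on the nose.
[cite: MochizukiEtTh2009, §5 p.322 (PDF p.96)] -/
theorem ofThetaSettingData_PiX : (ofThetaSettingData μ hC hS h Q R K' constEmb constEmb_injective hinvc hinvp).PiX = C.Huu := rfl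

/-- **`𝔉.PiYdd = Π^tp_Ÿ̲̲ = Π^tp_Ÿ ∩ Π^tp_X̲̲`**, on the nose. [cite: MochizukiEtTh2009, §5 p.330 (PDF p.104)] -/
theorem ofThetaSettingData_PiYdd :
    (ofThetaSettingData μ hC hS h Q R K' constEmb constEmb_injective hinvc hinvp).PiYdd = D.GtpYdd.subgroupOf C.Huu := rfl

/-- `𝔉.N = N`. [cite: MochizukiEtTh2009, §5 p.330 (PDF p.104)] -/
theorem ofThetaSettingData_N : (ofThetaSettingData μ hC hS h Q R K' constEmb constEmb_injective hinvc hinvp).N = N := rfl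

/-- `𝔉.l = l` (the `l` of Def. 2.5 (i) carried by the `DoubleUnderline` datum). [cite: MochizukiEtTh2009, Def 2.5 (i) p.39] -/
theorem ofThetaSettingData_l : ((ofThetaSettingData μ hC hS h Q R K' constEmb constEmb_injective hinvc hinvp).l : ℕ) = l := rfl

/-- **`Ker ρ_N = N_{A_N} ≤ Π^tp_X̲̲`, literally**: for the §5 data of the Setting, `ρ_N(g) = 1 ↔ g ∈ Π^tp_X̲̲` fixes the point `a` of the Galois
`Π^tp_X̲̲`-set `A_N^bs` ([SemiAnbd] Rmk. 3.1.3: every stabiliser is `N_{A_N}`) — abc-iut-L6-t23's kernel condition (binders hD1/hD2) with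
no `ιX` left.  [cite: MochizukiEtTh2009, §5 p.331 (PDF p.105)] -/
theorem rho_ofThetaSettingData_eq_one_iff (a : R.AN.base.obj.obj.V) (g : C.Huu) :
    (ofThetaSettingData μ hC hS h Q R K' constEmb constEmb_injective hinvc hinvp).ρ g = 1 ↔ R.AN.base.obj.obj.ρ g a = a :=
  rho_ofConnectedTemperoidData_eq_one_iff (T := C.thetaEnvData μ hC hS) h Q C.odd_lPNat R (ContinuousMulEquiv.refl _) K'
    constEmb constEmb_injective hinvc hinvp a g

/-- **`Facts` for the §5 data of the Setting** from `hH` (`Π^tp_Ÿ̲̲ ⊆ H_⊙`; a theorem for `A_⊙^bs := Ÿ̲̲`, below), `hconst` (Def. 3.6 (iii))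
and `hgc` (Lemma 5.8's geometric connectedness).  [cite: MochizukiEtTh2009, §5 p.330–331 (PDF pp.104–105); Lem 5.8 p.331 (PDF p.105)] -/
theorem facts_ofThetaSettingData
    (hH : ∀ y : (C.thetaEnvData μ hC hS).PiX, y ∈ (C.thetaEnvData μ hC hS).PiYdd →
      (ContinuousMulEquiv.refl _) y ∈ (BiKummerSetting.mkOfConnectedTemperoid (C.temperedArithmeticGroup e) tf hZ hP NH A₀ hA₀ hA₀').Hodot)
    (hconst : ∀ (ε : Aut R.BN) (k : K'ˣ), tf.biratAutModel R.BN ε (constEmb k) = constEmb k)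
    (hgc : ∀ u : (ofThetaSettingData μ hC hS h Q R K' constEmb constEmb_injective hinvc hinvp).units
        (ofThetaSettingData μ hC hS h Q R K' constEmb constEmb_injective hinvc hinvp).BN,
      (∀ y ∈ (ofThetaSettingData μ hC hS h Q R K' constEmb constEmb_injective hinvc hinvp).imPiY,
        (ofThetaSettingData μ hC hS h Q R K' constEmb constEmb_injective hinvc hinvp).sgpCap y *
          (u : Aut (ofThetaSettingData μ hC hS h Q R K' constEmb constEmb_injective hinvc hinvp).BN) *
          ((ofThetaSettingData μ hC hS h Q R K' constEmb constEmb_injective hinvc hinvp).sgpCap y)⁻¹ = u) →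
      (ofThetaSettingData μ hC hS h Q R K' constEmb constEmb_injective hinvc hinvp).unitsToBirat
          (ofThetaSettingData μ hC hS h Q R K' constEmb constEmb_injective hinvc hinvp).BN u ∈
        (ofThetaSettingData μ hC hS h Q R K' constEmb constEmb_injective hinvc hinvp).constEmb.range) :
    (ofThetaSettingData μ hC hS h Q R K' constEmb constEmb_injective hinvc hinvp).Facts :=
  facts_ofConnectedTemperoidData (T := C.thetaEnvData μ hC hS) h Q C.odd_lPNat R (ContinuousMulEquiv.refl _) K' constEmb
    constEmb_injective hinvc hinvp hH hconst hgc

end General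

section ThetaDivisor

variable
  (hθ : ∀ x : C.Huu, pull tf.divisorMonoid ((BiKummerSetting.mkOfConnectedTemperoid (C.temperedArithmeticGroup e) tf hZ hP NH A₀ hA₀ hA₀').galoisSurj
    A₀.base hA₀' x).hom (ModelFrobenioid.div Pl.num) = ModelFrobenioid.div Pl.num)
  (hθ' : ∀ x : C.Huu, pull tf.divisorMonoid ((BiKummerSetting.mkOfConnectedTemperoid (C.temperedArithmeticGroup e) tf hZ hP NH A₀ hA₀ hA₀').galoisSurj
    A₀.base hA₀' x).hom (ModelFrobenioid.div Pl.den) = ModelFrobenioid.div Pl.den)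

/-- **The §5 data of the Setting with the divisor inputs supplied from the `Π^tp_X̲̲`-stability `hθ`, `hθ'` of `Div(s')`, `Div(s'')`** of the
fraction-pair of `Θ̈` on `A_⊙` (§5 p.330 "`Div(s^⊓_N)` … descends to `A_⊚`"; Prop. 4.3 (i) proof p.317).
[cite: MochizukiEtTh2009, §5 p.330 (PDF p.104); Prop 4.3 (i) p.317 (PDF p.91)] -/
def ofThetaSettingDataOfThetaDivisor :
    ThetaFrobenioid.{0} (BiKummerSetting.mkOfConnectedTemperoid (C.temperedArithmeticGroup e) tf hZ hP NH A₀ hA₀ hA₀').C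
      (ConnectedPart (BTemp (C.temperedArithmeticGroup e).Pi)) :=
  ofThetaSettingData μ hC hS h Q R K' constEmb constEmb_injective (hinvc_ofConnectedTemperoid h R hθ)
    (hinvp_ofConnectedTemperoid (T := C.thetaEnvData μ hC hS) h R (ContinuousMulEquiv.refl _) hθ')

/-- Unfolding of `ofThetaSettingDataOfThetaDivisor` (definitional). [cite: MochizukiEtTh2009, §5 p.330 (PDF p.104)] -/
theorem ofThetaSettingDataOfThetaDivisor_eq :
    ofThetaSettingDataOfThetaDivisor μ hC hS h Q R K' constEmb constEmb_injective hθ hθ' =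
      ofThetaSettingData μ hC hS h Q R K' constEmb constEmb_injective (hinvc_ofConnectedTemperoid h R hθ)
        (hinvp_ofConnectedTemperoid (T := C.thetaEnvData μ hC hS) h R (ContinuousMulEquiv.refl _) hθ') := rfl

end ThetaDivisor

end ThetaFrobenioid

/-! ## `A_⊙^bs := Ÿ̲̲`: `hH` discharged -/

namespace ThetaFrobenioid

variable {p : ℕ} [Fact p.Prime] {D : ThetaSetting p} {E : D.EtaleThetaData} {l : ℕ} {C : E.DoubleUnderline l}
  {e : D.toTemperedCurve.GroupLevelData} {N : ℕ+} (μ : D.CyclotomeMod l N) (hC : D.Compat) (hS : D.Sec2Hyps)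
  {D₀ : Type} [Category.{v₀} D₀] {V : FrdIMonoidStub.{0}} {T₀ : RealifiedDivisorMonoids (D₀ := D₀) V}
  {VD : FrdICatStub.{1, 0, 0} (ConnectedPart (BTemp (C.temperedArithmeticGroup e).Pi))}
  {tf : TemperedFrobenioid T₀ (ConnectedPart (BTemp (C.temperedArithmeticGroup e).Pi)) VD} {hZ : tf.monoidType = MonoidType.Z}
  {hP : ∀ A : (ConnectedPart (BTemp (C.temperedArithmeticGroup e).Pi))ᵒᵖ, IsPerfect (tf.Φ.carrier A)}
  {NH : Subgroup (Field.absoluteGaloisGroup D.K) → tf.category → ℕ+ → Prop}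
  {pullFrac : ∀ {A A' : (BiKummerSetting.mkOfThetaSettingYdd C e μ hC hS tf hZ hP NH).C} (_ : A' ⟶ A),
    (BiKummerSetting.mkOfThetaSettingYdd C e μ hC hS tf hZ hP NH).biratUnits A →
      (BiKummerSetting.mkOfThetaSettingYdd C e μ hC hS tf hZ hP NH).biratUnits A'}
  {θ : (BiKummerSetting.mkOfThetaSettingYdd C e μ hC hS tf hZ hP NH).biratUnits (BiKummerSetting.mkOfThetaSettingYdd C e μ hC hS tf hZ hP NH).Aodot}
  {Bl : (BiKummerSetting.mkOfThetaSettingYdd C e μ hC hS tf hZ hP NH).C}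
  {Pl : (BiKummerSetting.mkOfThetaSettingYdd C e μ hC hS tf hZ hP NH).FractionPair θ Bl}
  {Rl : (BiKummerSetting.mkOfThetaSettingYdd C e μ hC hS tf hZ hP NH).NthRoot θ Pl C.lPNat pullFrac}
  (h : ModelFrobenioid.Hypotheses tf.divisorMonoid tf.ratFnFunctor)
  (Q : FrobenioidTheta.ThetaSubquotientStub.{0} (ConnectedPart (BTemp (C.temperedArithmeticGroup e).Pi)))
  (R : (BiKummerSetting.mkOfThetaSettingYdd C e μ hC hS tf hZ hP NH).NthRoot Rl.root Rl.pair N pullFrac)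
  (K' : Type) [Field K'] (constEmb : K'ˣ →* tf.biratUnitsModel R.BN) (constEmb_injective : Function.Injective constEmb)
  (hinvc : ∀ g : Aut R.AN.base,
    pull tf.divisorMonoid g.hom (ModelFrobenioid.div R.pair.num) = ModelFrobenioid.div R.pair.num)
  (hinvp : ∀ y : (C.thetaEnvData μ hC hS).PiX, y ∈ (C.thetaEnvData μ hC hS).PiYdd →
    pull tf.divisorMonoid ((BiKummerSetting.mkOfThetaSettingYdd C e μ hC hS tf hZ hP NH).galoisSurj
      R.AN.base R.αData.isGalois ((ContinuousMulEquiv.refl _) y)).hom (ModelFrobenioid.div R.pair.den) = ModelFrobenioid.div R.pair.den)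

/-- **`Facts` for the §5 data of the Setting with `A_⊙^bs := Ÿ̲̲`, from `hconst` and `hgc` ALONE** (`hH := hH_mkOfThetaSettingYdd`).
[cite: MochizukiEtTh2009, §5 p.330–331 (PDF pp.104–105); Lem 5.8 p.331 (PDF p.105)] -/
theorem facts_ofThetaSettingYddData
    (hconst : ∀ (ε : Aut R.BN) (k : K'ˣ), tf.biratAutModel R.BN ε (constEmb k) = constEmb k)
    (hgc : ∀ u : (ofThetaSettingData μ hC hS h Q R K' constEmb constEmb_injective hinvc hinvp).units
        (ofThetaSettingData μ hC hS h Q R K' constEmb constEmb_injective hinvc hinvp).BN,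
      (∀ y ∈ (ofThetaSettingData μ hC hS h Q R K' constEmb constEmb_injective hinvc hinvp).imPiY,
        (ofThetaSettingData μ hC hS h Q R K' constEmb constEmb_injective hinvc hinvp).sgpCap y *
          (u : Aut (ofThetaSettingData μ hC hS h Q R K' constEmb constEmb_injective hinvc hinvp).BN) *
          ((ofThetaSettingData μ hC hS h Q R K' constEmb constEmb_injective hinvc hinvp).sgpCap y)⁻¹ = u) →
      (ofThetaSettingData μ hC hS h Q R K' constEmb constEmb_injective hinvc hinvp).unitsToBirat
          (ofThetaSettingData μ hC hS h Q R K' constEmb constEmb_injective hinvc hinvp).BN u ∈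
        (ofThetaSettingData μ hC hS h Q R K' constEmb constEmb_injective hinvc hinvp).constEmb.range) :
    (ofThetaSettingData μ hC hS h Q R K' constEmb constEmb_injective hinvc hinvp).Facts :=
  facts_ofThetaSettingData μ hC hS h Q R K' constEmb constEmb_injective hinvc hinvp
    (BiKummerSetting.hH_mkOfThetaSettingYdd C e μ hC hS tf hZ hP NH) hconst hgc

end ThetaFrobenioid

/-! ## The tower of the Setting: all levels `M ∈ E` over t8's `thetaEnvTower` (Rmk. 4.3.2 "compatible systems") -/

namespace ThetaFrobenioidTower

variable {p : ℕ} [Fact p.Prime] {D : ThetaSetting p} {E : D.EtaleThetaData} {l : ℕ} {C : E.DoubleUnderline l}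
  {e : D.toTemperedCurve.GroupLevelData} {Es : Set ℕ+} (τ : D.CyclotomeTower l Es) (hC : D.Compat) (hS : D.Sec2Hyps)
  {D₀ : Type} [Category.{v₀} D₀] {V : FrdIMonoidStub.{0}} {T₀ : RealifiedDivisorMonoids (D₀ := D₀) V}
  {VD : FrdICatStub.{1, 0, 0} (ConnectedPart (BTemp (C.temperedArithmeticGroup e).Pi))}
  {tf : TemperedFrobenioid T₀ (ConnectedPart (BTemp (C.temperedArithmeticGroup e).Pi)) VD} {hZ : tf.monoidType = MonoidType.Z}
  {hP : ∀ A : (ConnectedPart (BTemp (C.temperedArithmeticGroup e).Pi))ᵒᵖ, IsPerfect (tf.Φ.carrier A)}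
  {NH : Subgroup (Field.absoluteGaloisGroup D.K) → tf.category → ℕ+ → Prop} {A₀ : tf.category}
  {hA₀ : PreFrobenioid.IsFrobeniusTrivial tf.toElem A₀} {hA₀' : SemiGraphs.IsGaloisObj A₀.base.obj}
  {pullFrac : ∀ {A A' : (BiKummerSetting.mkOfConnectedTemperoid (C.temperedArithmeticGroup e) tf hZ hP NH A₀ hA₀ hA₀').C} (_ : A' ⟶ A),
    (BiKummerSetting.mkOfConnectedTemperoid (C.temperedArithmeticGroup e) tf hZ hP NH A₀ hA₀ hA₀').biratUnits A →
      (BiKummerSetting.mkOfConnectedTemperoid (C.temperedArithmeticGroup e) tf hZ hP NH A₀ hA₀ hA₀').biratUnits A'}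
  {θ : (BiKummerSetting.mkOfConnectedTemperoid (C.temperedArithmeticGroup e) tf hZ hP NH A₀ hA₀ hA₀').biratUnits
    (BiKummerSetting.mkOfConnectedTemperoid (C.temperedArithmeticGroup e) tf hZ hP NH A₀ hA₀ hA₀').Aodot}
  {Bl : (BiKummerSetting.mkOfConnectedTemperoid (C.temperedArithmeticGroup e) tf hZ hP NH A₀ hA₀ hA₀').C}
  {Pl : (BiKummerSetting.mkOfConnectedTemperoid (C.temperedArithmeticGroup e) tf hZ hP NH A₀ hA₀ hA₀').FractionPair θ Bl}
  {Rl : (BiKummerSetting.mkOfConnectedTemperoid (C.temperedArithmeticGroup e) tf hZ hP NH A₀ hA₀ hA₀').NthRoot θ Pl C.lPNat pullFrac}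
  (h : ModelFrobenioid.Hypotheses tf.divisorMonoid tf.ratFnFunctor)
  (Q : FrobenioidTheta.ThetaSubquotientStub.{0} (ConnectedPart (BTemp (C.temperedArithmeticGroup e).Pi)))
  (R : ∀ N : ℕ+, (BiKummerSetting.mkOfConnectedTemperoid (C.temperedArithmeticGroup e) tf hZ hP NH A₀ hA₀ hA₀').NthRoot Rl.root Rl.pair N pullFrac)
  (K' : Type) [Field K'] (constEmb : ∀ N : ℕ+, K'ˣ →* tf.biratUnitsModel (R N).BN)
  (constEmb_injective : ∀ N : ℕ+, Function.Injective (constEmb N))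
  (hinvc : ∀ (N : ℕ+) (g : Aut (R N).AN.base),
    pull tf.divisorMonoid g.hom (ModelFrobenioid.div (R N).pair.num) = ModelFrobenioid.div (R N).pair.num)
  (hinvp : ∀ (N : ℕ+) (y : (C.thetaEnvTower τ hC hS).PiX), y ∈ (C.thetaEnvTower τ hC hS).PiYdd →
    pull tf.divisorMonoid ((BiKummerSetting.mkOfConnectedTemperoid (C.temperedArithmeticGroup e) tf hZ hP NH A₀ hA₀ hA₀').galoisSurj
      (R N).AN.base (R N).αData.isGalois ((ContinuousMulEquiv.refl _) y)).hom (ModelFrobenioid.div (R N).pair.den) =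
        ModelFrobenioid.div (R N).pair.den)
  (α : ∀ {N N' : ℕ+}, (N : ℕ) ∣ N' → ((R N').AN ⟶ (R N).AN))
  (β : ∀ {N N' : ℕ+}, (N : ℕ) ∣ N' → ((R N').BN ⟶ (R N).BN))
  (comm_sCap : ∀ {N N' : ℕ+} (hd : (N : ℕ) ∣ N'), (R N').pair.num ≫ β hd = α hd ≫ (R N).pair.num)
  (comm_sCup : ∀ {N N' : ℕ+} (hd : (N : ℕ) ∣ N'), (R N').pair.den ≫ β hd = α hd ≫ (R N).pair.den)
  (isIsometry_α : ∀ {N N' : ℕ+} (hd : (N : ℕ) ∣ N'),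
    ((BiKummerSetting.mkOfConnectedTemperoid (C.temperedArithmeticGroup e) tf hZ hP NH A₀ hA₀ hA₀').sec5Stub h).pre.IsIsometry (α hd))
  (degFr_α : ∀ {N N' : ℕ+} (hd : (N : ℕ) ∣ N'),
    (((BiKummerSetting.mkOfConnectedTemperoid (C.temperedArithmeticGroup e) tf hZ hP NH A₀ hA₀ hA₀').sec5Stub h).pre.degFr (α hd) : ℕ) *
      N = N')
  (isIsometry_β : ∀ {N N' : ℕ+} (hd : (N : ℕ) ∣ N'),
    ((BiKummerSetting.mkOfConnectedTemperoid (C.temperedArithmeticGroup e) tf hZ hP NH A₀ hA₀ hA₀').sec5Stub h).pre.IsIsometry (β hd))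
  (degFr_β : ∀ {N N' : ℕ+} (hd : (N : ℕ) ∣ N'),
    (((BiKummerSetting.mkOfConnectedTemperoid (C.temperedArithmeticGroup e) tf hZ hP NH A₀ hA₀ hA₀').sec5Stub h).pre.degFr (β hd) : ℕ) *
      N = N')
  (baseFrob_α : ∀ {N N' : ℕ+} (hd : (N : ℕ) ∣ N'),
    (BiKummerSetting.mkOfConnectedTemperoid (C.temperedArithmeticGroup e) tf hZ hP NH A₀ hA₀ hA₀').IsOfBaseFrobeniusType (α hd))

/-- **The [EtTh] §5 tower OF THE SETTING** (Rmk. 4.3.2 "by allowing `N` to vary … compatible systems", pp.318–319 (PDF pp.92–93);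
§5 pp.330–331): gen 3's `ofConnectedTemperoidFamily` over `B^temp(Π^tp_X̲̲)⁰` with the projective system of §2 data `𝒯 :=` abc-iut-L2-t8's
`C.thetaEnvTower τ hC hS` (`TowerOfSetting.lean`: real reductions `μ_{M'} ↠ μ_M`, all axioms proved there) and `ιX := id`.  Inputs left:
the roots `R N`, the Rmk. 4.3.2 transitions `α, β` with their squares / isometry / degree / base-Frobenius clauses, the constants, the
divisor invariances, `τ : CyclotomeTower` (the compatible identifications `μ_M ≅ (l·Δ_Θ) ⊗ ℤ/M`).
[cite: MochizukiEtTh2009, Rmk 4.3.2 p.318–319 (PDF pp.92–93); §5 p.330–331 (PDF pp.104–105)] -/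
def ofThetaSettingFamily :
    ThetaFrobenioidTower.{0} (BiKummerSetting.mkOfConnectedTemperoid (C.temperedArithmeticGroup e) tf hZ hP NH A₀ hA₀ hA₀').C
      (ConnectedPart (BTemp (C.temperedArithmeticGroup e).Pi)) :=
  ofConnectedTemperoidFamily (𝒯 := C.thetaEnvTower τ hC hS) h Q C.odd_lPNat R (ContinuousMulEquiv.refl _) K' constEmb
    constEmb_injective hinvc hinvp α β comm_sCap comm_sCup isIsometry_α degFr_α isIsometry_β degFr_β baseFrob_α

/-- `ofThetaSettingFamily` IS `ofConnectedTemperoidFamily` at `(X, 𝒯, ιX) := (Π^tp_X̲̲, C.thetaEnvTower τ hC hS, id)` (definitionally).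
[cite: MochizukiEtTh2009, §5 p.330–331 (PDF pp.104–105)] -/
theorem ofThetaSettingFamily_eq :
    ofThetaSettingFamily τ hC hS h Q R K' constEmb constEmb_injective hinvc hinvp α β comm_sCap comm_sCup isIsometry_α degFr_α
        isIsometry_β degFr_β baseFrob_α =
      ofConnectedTemperoidFamily (𝒯 := C.thetaEnvTower τ hC hS) h Q C.odd_lPNat R (ContinuousMulEquiv.refl _) K' constEmb
        constEmb_injective hinvc hinvp α β comm_sCap comm_sCup isIsometry_α degFr_α isIsometry_β degFr_β baseFrob_α := rfl

/-- **The level `M ∈ E` of the tower of the Setting IS the §5 data of the Setting at the identification `τ.mod M`** (definitionally):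
`atLevel M = ofThetaSettingData (τ.mod M) hC hS …`.  [cite: MochizukiEtTh2009, §5 p.330–331 (PDF pp.104–105)] -/
theorem atLevel_ofThetaSettingFamily_eq (M : Es) :
    (ofThetaSettingFamily τ hC hS h Q R K' constEmb constEmb_injective hinvc hinvp α β comm_sCap comm_sCup isIsometry_α degFr_α
        isIsometry_β degFr_β baseFrob_α).atLevel M =
      ThetaFrobenioid.ofThetaSettingData (τ.mod M) hC hS h Q (R M) K' (constEmb M) (constEmb_injective M) (hinvc M) (hinvp M) := rfl

/-- **`Ker ρ_N = N_{A_N} ≤ Π^tp_X̲̲` at every level of the tower of the Setting**: `ρ_N(g) = 1 ↔ g` fixes the point `a` of `A_N^bs`.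
[cite: MochizukiEtTh2009, §5 p.331 (PDF p.105)] -/
theorem rhoFamily_ofThetaSetting_eq_one_iff (N : ℕ+) (a : (R N).AN.base.obj.obj.V) (g : C.Huu) :
    rhoFamily (𝒯 := C.thetaEnvTower τ hC hS) R (ContinuousMulEquiv.refl _) N g = 1 ↔ (R N).AN.base.obj.obj.ρ g a = a :=
  ThetaFrobenioid.rhoFamily_eq_one_iff (𝒯 := C.thetaEnvTower τ hC hS) R (ContinuousMulEquiv.refl _) N a g

end ThetaFrobenioidTower

end Literature.AnabelianGeometry.EtaleTheta

end
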